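import Summits.NavierStokesRegularity.FluidComputer.DissipationConcentrationFace
import Literature.Analysis.FluidPDE.GigaMiura2011LocalCriterionHolds
import Literature.Analysis.FluidPDE.BesovBlowupConcentration
import Literature.Analysis.FluidPDE.SuitableWeakInBallTools
import Literature.Analysis.FluidPDE.DirectionDissipation
import HarnessLib

/-!
# Fluid computer — the level dictionary, TYPE-I DIRECTION FACE (L49): under a local Type-I bound at the focus,
# the vorticity direction has NO modulus of continuity over the intense set (Giga–Miura, local form)

HONEST FRAMING (cell `pub-fluidc`, verbatim): *low prior, high value-of-information experiment on Tao's
machine paradigm; NOT a claim that NS blows up.* Theorem side of the cell; nothing here is evidence of blow-up.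
L32/L48 say that over the intense set the vorticity direction `ξ = ω/|ω|` is neither Lipschitz- nor
½-Hölder-coherent in any terminal window (GLOBAL in space, a modulus of a fixed power type). Giga–Miura's LOCAL
criterion under a Type-I bound (Comm. Math. Phys. 303 (2011), Thm. 2.10 — PROVED in the tree as
`gigaMiura2011_local_continuousAlignment_typeI_holds`: blow-up / compactness to a mild bounded ancient solution with
continuously aligned vorticity, which is two-dimensional, hence trivial by the KNSS Liouville theorem) removes
BOTH restrictions CONDITIONALLY: if near the focus the solution is locally Type I, then `ξ` admits NO modulus of
continuity whatsoever over `{|ω| > d}` near the focus, for every `d > 0`. Read on the class (viscosity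
normalisation `CKNFace.rescaled_classical_lerayHopf`, the Albritton–Barker class at the final-time apex
`isSuitableWeakSolutionInBall_apex_of_classical` fed by `DissipationConcentrationFace.lemma42_hypotheses`, the
parabolic zoom `IsSuitableWeakSolutionInBall.zoom` onto the unit cylinder, `curl_smul_stPull` and
`vorticityDirection_const_smul` for the covariance of `ω` and `ξ`), for every classical solution `(u, p)` of the
unforced Navier–Stokes system on `ℝ³ × [0, T)` (`ν > 0`), Leray–Hopf from `u 0`, and every point `x₀` at which
`u` is unbounded on every backward parabolic neighbourhood of `(T, x₀)`:

* `typeI_direction_no_modulus_at` (**L49**): if for some `t₁ < T`, `R > 0`, `C` the LOCAL TYPE-I bound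
  `√(T − τ)·‖u(τ, x)‖ ≤ C` holds for `τ ∈ (t₁, T)`, `x ∈ B(x₀, R)`, then for every `d > 0` and every modulus `η`
  (monotone and continuous on `[0, ∞)`, `η(0) = 0`) the uniform-continuity bound
  `‖ξ(τ, x) − ξ(τ, x')‖ ≤ η(‖x − x'‖)` over `{x, x' ∈ B(x₀, R) : |ω(τ,x)|, |ω(τ,x')| > d}`, `τ ∈ (t₁, T)`, FAILS;
* `typeI_direction_no_modulus` (**L49 at the focus of L33′**, maximal solutions).

Reading for the machine paradigm (words): a machine running at the self-similar (Type-I) rate near its focus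
must twist its intense vortex lines there WITHOUT ANY uniform modulus — at the parabolic scale the direction field
is genuinely discontinuous in the limit; combined with L40 (axisymmetric ⇒ not Type I) and L43 (Type I ⇒ critical
mass locked in the parabolic ball). Conditional on the local Type-I bound; qualitative. Necessity only. 0 sorry;
no new definitions, no named facts.

## References

* Y. Giga, H. Miura, Comm. Math. Phys. 303 (2011) 289–300, Thm. 2.10, Rmk. 2.11. [GigaMiura2011]
* G. Seregin, V. Šverák, Comm. PDE 34 (2009) 171–201, Thm. 2.8. [SereginSverak2009]
* D. Albritton, T. Barker, Arch. Ration. Mech. Anal. 232 (2019), Def. 2.1. [AlbrittonBarker2019]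
-/

noncomputable section

open MeasureTheory Set Function Filter Topology TopologicalSpace Metric
open scoped ENNReal NNReal
open Literature.Analysis.FluidPDE Literature.Analysis.FunctionSpaces
open Summit.NavierStokesRegularity.FluidComputer.LocalisationFace
open Summit.NavierStokesRegularity.FluidComputer.CKNFace
open Summit.NavierStokesRegularity.FluidComputer.DissipationConcentrationFace

namespace Summit.NavierStokesRegularity.FluidComputer.TypeIDirectionFace

/-- **L49 — UNDER A LOCAL TYPE-I BOUND AT A SINGULAR POINT, THE VORTICITY DIRECTION HAS NO MODULUS OF CONTINUITY
OVER THE INTENSE SET THERE** (Giga–Miura 2011, Thm. 2.10, PROVED in the tree, read on the class). Let `(u, p)` be a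
classical solution of the unforced Navier–Stokes system on `ℝ³ × [0, T)` (`ν > 0`, `T > 0`), Leray–Hopf from `u 0`,
`x₀` a point at which `u` is unbounded on every backward parabolic neighbourhood of `(T, x₀)`, and suppose the local
Type-I bound `√(T − τ)‖u(τ, x)‖ ≤ C` for `τ ∈ (t₁, T)`, `x ∈ B(x₀, R)` (`0 ≤ t₁ < T`, `R > 0`, `C > 0`). Then for every
`d > 0` and every modulus `η` (monotone and continuous on `[0, ∞)`, `η 0 = 0`) it is NOT the case that
`‖ξ(τ,x) − ξ(τ,x')‖ ≤ η ‖x − x'‖` for all `τ ∈ (t₁, T)` and all `x, x' ∈ B(x₀, R)` with `‖ω(τ,x)‖, ‖ω(τ,x')‖ > d`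
(`ω = curl (u τ)`, `ξ = vorticityDirection ω`). Proof: zoom `(T, x₀)` with `ρ = √(ν(T − t₁))` onto the unit
cylinder at unit viscosity; the zoomed field satisfies Giga–Miura's hypotheses (`C¹` slices, `√(−t)|v| ≤ C/√ν`,
modulus `η(ρ ·)` above the threshold `ρ²ν⁻¹d`), hence is bounded near the vertex — so `u` is bounded on a
backward cylinder at `(T, x₀)`, contradicting the singularity.
[cite: GigaMiura2011, Thm 2.10 with Def. 2.9 and Rmk 2.11 (§2.2)] [cite: SereginSverak2009, Thm 2.8] -/
theorem typeI_direction_no_modulus_at {ν T : ℝ} (hν : 0 < ν) (hT : 0 < T)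
    {u : ℝ → EuclideanSpace ℝ (Fin 3) → EuclideanSpace ℝ (Fin 3)} {p : ℝ → EuclideanSpace ℝ (Fin 3) → ℝ}
    (hcl : IsClassicalNSSolutionOn (Ico 0 T) ν 0 u p) (hLH : IsLerayHopfOn T ν 0 (u 0) u)
    {x₀ : EuclideanSpace ℝ (Fin 3)}
    (hsing : ∀ r : ℝ, 0 < r → ∀ M : ℝ, ∃ t ∈ Ioo (T - r ^ 2) T, 0 < t ∧ ∃ x ∈ ball x₀ r, M < ‖u t x‖)
    {t₁ : ℝ} (ht₁ : t₁ ∈ Ico 0 T) {R C : ℝ} (hR : 0 < R) (hC : 0 < C)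
    (htypeI : ∀ τ ∈ Ioo t₁ T, ∀ x ∈ ball x₀ R, Real.sqrt (T - τ) * ‖u τ x‖ ≤ C)
    {d : ℝ} (hd : 0 < d) {η : ℝ → ℝ} (hηm : MonotoneOn η (Ici 0)) (hηc : ContinuousOn η (Ici 0))
    (hη0 : η 0 = 0) :
    ¬ (∀ τ ∈ Ioo t₁ T, ∀ x ∈ ball x₀ R, ∀ x' ∈ ball x₀ R,
        d < ‖curl (u τ) x‖ → d < ‖curl (u τ) x'‖ →
          ‖vorticityDirection (curl (u τ)) x - vorticityDirection (curl (u τ)) x'‖ ≤ η ‖x - x'‖) := by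
  intro hmod
  -- ## scales
  set L : ℝ := T - t₁ with hLdef
  have hL : 0 < L := sub_pos.2 ht₁.2
  set ρ : ℝ := Real.sqrt (ν * L) with hρdef
  have hνL : 0 < ν * L := mul_pos hν hL
  have hρ : 0 < ρ := Real.sqrt_pos.2 hνL
  have hρ2 : ρ ^ 2 = ν * L := Real.sq_sqrt hνL.le
  have hLt : ρ ^ 2 / ν = L := by rw [hρ2]; field_simp
  -- ## the viscosity-normalised solution and the Albritton–Barker class at the apex `(νT, x₀)`
  set w : ℝ → EuclideanSpace ℝ (Fin 3) → EuclideanSpace ℝ (Fin 3) := timeRescale ν⁻¹ ν⁻¹ u with hwdef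
  set π : ℝ → EuclideanSpace ℝ (Fin 3) → ℝ := timeRescale ν⁻¹ (ν⁻¹ ^ 2) p with hπdef
  have hTν : 0 < T * ν := mul_pos hT hν
  obtain ⟨hclw, hLHw⟩ := rescaled_classical_lerayHopf hν hT hcl hLH
  have hρT : ρ ^ 2 ≤ T * ν := by rw [hρ2, hLdef, mul_comm]; nlinarith [ht₁.1]
  obtain ⟨-, -, -, hE, -⟩ := lemma42_hypotheses hTν hclw hLHw x₀ hρ hρT
  have hball₀ := isSuitableWeakSolutionInBall_apex_of_classical hTν hclw hLHw (x₀ := x₀) hρT hE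
  -- ## zoom onto the unit cylinder
  have hball₁ := hball₀.zoom hρ
  set c : ℝ := ρ * ν⁻¹ with hcdef
  have hc : 0 < c := mul_pos hρ (inv_pos.2 hν)
  set v : ℝ → EuclideanSpace ℝ (Fin 3) → EuclideanSpace ℝ (Fin 3) := c • stPull (ρ ^ 2 / ν) ρ T x₀ u
    with hvdef
  have hv_apply : ∀ t y, v t y = c • u (T + ρ ^ 2 / ν * t) (x₀ + ρ • y) := fun t y => rfl
  have hv : ρ • stPull (ρ ^ 2) ρ ((T * ν : ℝ), x₀).1 ((T * ν : ℝ), x₀).2 w = v := by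
    funext t y
    rw [hv_apply, smul_stPull_apply, hwdef, timeRescale_apply, smul_smul]
    have e : ν⁻¹ * (T * ν + ρ ^ 2 * t) = T + ρ ^ 2 / ν * t := by field_simp
    rw [e]
  rw [hv] at hball₁
  -- ## the time and space maps
  have hτ : ∀ t ∈ Ioo (-1 : ℝ) 0, T + ρ ^ 2 / ν * t ∈ Ioo t₁ T := by
    intro t ht
    rw [hLt]
    constructor <;> nlinarith [ht.1, ht.2, hL]
  set r₀ : ℝ := min (R / ρ) (1 / 2) with hr₀def
  have hr₀ : 0 < r₀ := lt_min (div_pos hR hρ) (by norm_num)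
  have hr₀1 : r₀ < 1 := (min_le_right _ _).trans_lt (by norm_num)
  have hr₀R : ρ * r₀ ≤ R := by
    have h1 : r₀ ≤ R / ρ := min_le_left _ _
    calc ρ * r₀ ≤ ρ * (R / ρ) := mul_le_mul_of_nonneg_left h1 hρ.le
      _ = R := by field_simp
  have hx : ∀ y ∈ ball (0 : EuclideanSpace ℝ (Fin 3)) r₀, x₀ + ρ • y ∈ ball x₀ R := by
    intro y hy
    rw [mem_ball_zero_iff] at hy
    rw [mem_ball, dist_eq_norm, add_sub_cancel_left, norm_smul, Real.norm_of_nonneg hρ.le]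
    calc ρ * ‖y‖ < ρ * r₀ := mul_lt_mul_of_pos_left hy hρ
      _ ≤ R := hr₀R
  -- ## Giga–Miura's hypotheses for `v`
  -- `C¹` slices
  have hC1 : ∀ t ∈ Ioo (-1 : ℝ) 0, ContDiffOn ℝ 1 (v t) (ball (0 : EuclideanSpace ℝ (Fin 3)) r₀) := by
    intro t ht
    have hτt := hτ t ht
    have hu : ContDiff ℝ 1 (u (T + ρ ^ 2 / ν * t)) :=
      (hcl.contDiff_velocity ⟨ht₁.1.trans hτt.1.le, hτt.2⟩).of_le (by norm_cast)
    have haff : ContDiff ℝ 1 (fun y : EuclideanSpace ℝ (Fin 3) => x₀ + ρ • y) := by fun_prop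
    have e : v t = fun y => c • u (T + ρ ^ 2 / ν * t) (x₀ + ρ • y) := funext (hv_apply t)
    rw [e]
    exact ((hu.comp haff).const_smul c).contDiffOn
  -- local Type I
  have hsν : 0 < Real.sqrt ν := Real.sqrt_pos.2 hν
  have hC₀ : 0 < C / Real.sqrt ν := div_pos hC hsν
  have hsL : 0 < Real.sqrt L := Real.sqrt_pos.2 hL
  have hcL : c / Real.sqrt L = 1 / Real.sqrt ν := by
    have h1 : ρ = Real.sqrt ν * Real.sqrt L := by rw [hρdef, Real.sqrt_mul hν.le]
    calc c / Real.sqrt L = Real.sqrt ν * ν⁻¹ * (Real.sqrt L / Real.sqrt L) := by rw [hcdef, h1]; ring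
      _ = Real.sqrt ν / ν := by rw [div_self hsL.ne', mul_one, div_eq_mul_inv]
      _ = 1 / Real.sqrt ν := Real.sqrt_div_self'
  have hrate : ∀ t ∈ Ioo (-1 : ℝ) 0, ∀ y ∈ ball (0 : EuclideanSpace ℝ (Fin 3)) r₀,
      Real.sqrt (-t) * ‖v t y‖ ≤ C / Real.sqrt ν := by
    intro t ht y hy
    have hτt := hτ t ht
    have hval : ‖v t y‖ = c * ‖u (T + ρ ^ 2 / ν * t) (x₀ + ρ • y)‖ := by
      rw [hv_apply, norm_smul, Real.norm_of_nonneg hc.le]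
    have hneg : -t = (T - (T + ρ ^ 2 / ν * t)) / L := by
      rw [hLt]
      field_simp
      ring
    have hsq : Real.sqrt (-t) = Real.sqrt (T - (T + ρ ^ 2 / ν * t)) / Real.sqrt L := by
      rw [hneg, Real.sqrt_div' _ hL.le]
    have key := htypeI _ hτt _ (hx y hy)
    calc Real.sqrt (-t) * ‖v t y‖
        = (c / Real.sqrt L) * (Real.sqrt (T - (T + ρ ^ 2 / ν * t)) * ‖u (T + ρ ^ 2 / ν * t) (x₀ + ρ • y)‖) := by
          rw [hsq, hval]
          ring
      _ ≤ (c / Real.sqrt L) * C := mul_le_mul_of_nonneg_left key (by positivity)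
      _ = C / Real.sqrt ν := by rw [hcL]; ring
  -- continuous alignment above the zoomed threshold
  have hcρ : 0 < c * ρ := mul_pos hc hρ
  have hcurl : ∀ t y, curl (v t) y = (c * ρ) • curl (u (T + ρ ^ 2 / ν * t)) (x₀ + ρ • y) :=
    fun t y => curl_smul_stPull c (ρ ^ 2 / ν) ρ T x₀ u t y
  have hdir : ∀ t y, vorticityDirection (curl (v t)) y =
      vorticityDirection (curl (u (T + ρ ^ 2 / ν * t))) (x₀ + ρ • y) := by
    intro t y
    rw [vorticityDirection_apply, vorticityDirection_apply, hcurl t y, norm_smul, Real.norm_eq_abs,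
      abs_of_pos hcρ, mul_inv, smul_smul, mul_right_comm, inv_mul_cancel₀ hcρ.ne', one_mul]
  have hCA : ∃ d' : ℝ, 0 < d' ∧ ∃ η' : ℝ → ℝ, MonotoneOn η' (Ici 0) ∧ ContinuousOn η' (Ici 0) ∧ η' 0 = 0 ∧
      ∀ t ∈ Ioo (-1 : ℝ) 0, ∀ y ∈ ball (0 : EuclideanSpace ℝ (Fin 3)) r₀,
        ∀ y' ∈ ball (0 : EuclideanSpace ℝ (Fin 3)) r₀,
        d' < ‖curl (v t) y‖ → d' < ‖curl (v t) y'‖ →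
          ‖vorticityDirection (curl (v t)) y - vorticityDirection (curl (v t)) y'‖ ≤ η' ‖y - y'‖ := by
    refine ⟨c * ρ * d, by positivity, fun s => η (ρ * s), ?_, ?_, ?_, ?_⟩
    · intro a ha b hb hab
      exact hηm (mem_Ici.2 (mul_nonneg hρ.le ha)) (mem_Ici.2 (mul_nonneg hρ.le hb))
        (mul_le_mul_of_nonneg_left hab hρ.le)
    · exact hηc.comp (continuous_const.mul continuous_id).continuousOn
        fun s hs => mem_Ici.2 (mul_nonneg hρ.le hs)
    · simp only [mul_zero, hη0]
    · intro t ht y hy y' hy' hdy hdy'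
      have hτt := hτ t ht
      rw [hcurl, norm_smul, Real.norm_of_nonneg hcρ.le] at hdy hdy'
      have hdu : d < ‖curl (u (T + ρ ^ 2 / ν * t)) (x₀ + ρ • y)‖ := lt_of_mul_lt_mul_left hdy hcρ.le
      have hdu' : d < ‖curl (u (T + ρ ^ 2 / ν * t)) (x₀ + ρ • y')‖ := lt_of_mul_lt_mul_left hdy' hcρ.le
      rw [hdir, hdir]
      have key := hmod _ hτt _ (hx y hy) _ (hx y' hy') hdu hdu'
      have hxx' : ‖(x₀ + ρ • y) - (x₀ + ρ • y')‖ = ρ * ‖y - y'‖ := by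
        rw [add_sub_add_left_eq_sub, ← smul_sub, norm_smul, Real.norm_of_nonneg hρ.le]
      rw [hxx'] at key
      exact key
  -- ## Giga–Miura: `v` is bounded near the vertex
  have hball₁' : IsSuitableWeakSolutionInBall 1 ((0 : ℝ), (0 : EuclideanSpace ℝ (Fin 3))) v
      (ρ ^ 2 • stPull (ρ ^ 2) ρ ((T * ν : ℝ), x₀).1 ((T * ν : ℝ), x₀).2
        (fun t x => π t x - (π t 0 - normalisedPressure (w t) 0))) := hball₁
  obtain ⟨r, hr, hreg⟩ :=
    gigaMiura2011_local_continuousAlignment_typeI_holds hball₁' hr₀ hr₀1 hC₀ hC1 hrate hCA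
  -- ## back to `u`: pointwise bound on the part of the cylinder inside `(-1, 0) × B(0, r₀)`
  set r₂ : ℝ := min r (1 / 2) with hr₂def
  have hr₂ : 0 < r₂ := lt_min hr (by norm_num)
  have hr₂r : r₂ ≤ r := min_le_left _ _
  have hr₂1 : r₂ ^ 2 < 1 := by
    have h : r₂ ≤ 1 / 2 := min_le_right r (1 / 2)
    have h' := pow_le_pow_left₀ hr₂.le h 2
    norm_num at h'
    linarith
  set V : Set (ℝ × EuclideanSpace ℝ (Fin 3)) :=
    parabolicCylinder r₂ ((0 : ℝ), (0 : EuclideanSpace ℝ (Fin 3))) with hV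
  have hVsub : V ⊆ parabolicCylinder r ((0 : ℝ), (0 : EuclideanSpace ℝ (Fin 3))) := by
    intro z hz
    rw [hV, mem_parabolicCylinder] at hz
    rw [mem_parabolicCylinder]
    refine ⟨⟨?_, hz.1.2⟩, hz.2.trans_le hr₂r⟩
    have h1 := hz.1.1
    simp only at h1 ⊢
    linarith [pow_le_pow_left₀ hr₂.le hr₂r 2]
  set N : ℝ := (eLpNorm (uncurry v) ∞ (volume.restrict V)).toReal with hN
  have hregV : eLpNorm (uncurry v) ∞ (volume.restrict V) < ⊤ :=
    (eLpNorm_mono_measure _ (Measure.restrict_mono hVsub le_rfl)).trans_lt hreg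
  have hae : ∀ᵐ z ∂(volume.restrict V), ‖uncurry v z‖ ≤ N := by
    filter_upwards [ae_le_eLpNormEssSup (f := uncurry v) (μ := volume.restrict V)] with z hz
    rw [← eLpNorm_exponent_top] at hz
    rw [← ofReal_norm] at hz
    exact (ENNReal.ofReal_le_iff_le_toReal hregV.ne).1 hz
  have hVo : IsOpen V := isOpen_parabolicCylinder _ _
  have hVt : ∀ z ∈ V, z.1 ∈ Ioo (-1 : ℝ) 0 := by
    intro z hz
    rw [hV, mem_parabolicCylinder] at hz
    have h1 := hz.1.1
    have h2 := hz.1.2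
    simp only at h1 h2
    exact ⟨by linarith, h2⟩
  have hcont : ContinuousOn (uncurry v) V := by
    have hu := SereginSverak2002.continuousOn_uncurry hcl
    have hφ : Continuous (fun z : ℝ × EuclideanSpace ℝ (Fin 3) => (T + ρ ^ 2 / ν * z.1, x₀ + ρ • z.2)) := by
      fun_prop
    have hmaps : MapsTo (fun z : ℝ × EuclideanSpace ℝ (Fin 3) => (T + ρ ^ 2 / ν * z.1, x₀ + ρ • z.2)) V
        (Ico 0 T ×ˢ (univ : Set (EuclideanSpace ℝ (Fin 3)))) := by
      intro z hz
      have h := hτ z.1 (hVt z hz)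
      exact ⟨⟨ht₁.1.trans h.1.le, h.2⟩, mem_univ _⟩
    have hcomp := (hu.comp hφ.continuousOn hmaps).const_smul c
    refine hcomp.congr fun z _ => ?_
    simp only [uncurry, Function.comp_apply, Pi.smul_apply, hv_apply]
  have hpt : ∀ z ∈ V, ‖uncurry v z‖ ≤ N :=
    SereginSverak2002.norm_le_of_ae_restrict_of_continuousOn hVo hcont hae
  -- the singular point of `u`: radius `r' = ρ r₂/(1 + √ν)`, threshold `N / c`
  set r' : ℝ := ρ * r₂ / (1 + Real.sqrt ν) with hr'
  have hsq0 : 0 ≤ Real.sqrt ν := Real.sqrt_nonneg ν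
  have hr'0 : 0 < r' := by rw [hr']; positivity
  have hr'def : r' * (1 + Real.sqrt ν) = ρ * r₂ := by rw [hr']; field_simp
  have hlin : Real.sqrt ν * r' = ρ * r₂ - r' := by linear_combination hr'def
  have hsr : 0 ≤ Real.sqrt ν * r' := mul_nonneg hsq0 hr'0.le
  have hr'ρ : r' ≤ ρ * r₂ := by linarith
  have hνr : ν * r' ^ 2 ≤ (ρ * r₂) ^ 2 := by
    have h1 : Real.sqrt ν * r' ≤ ρ * r₂ := by linarith
    have h2 : 0 ≤ Real.sqrt ν * r' := hsr
    calc ν * r' ^ 2 = (Real.sqrt ν * r') ^ 2 := by rw [mul_pow, Real.sq_sqrt hν.le]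
      _ ≤ (ρ * r₂) ^ 2 := pow_le_pow_left₀ h2 h1 2
  obtain ⟨τ, hτI, -, x, hxI, hbig⟩ := hsing r' hr'0 (N / c)
  -- the preimage point `(t, y)` in `V`
  set t : ℝ := (τ - T) / L with htdef
  set y : EuclideanSpace ℝ (Fin 3) := ρ⁻¹ • (x - x₀) with hydef
  have hτt : T + ρ ^ 2 / ν * t = τ := by rw [hLt, htdef]; field_simp; ring
  have hxy : x₀ + ρ • y = x := by
    rw [hydef, smul_smul, mul_inv_cancel₀ hρ.ne', one_smul, add_sub_cancel]
  have hmem : ((t, y) : ℝ × EuclideanSpace ℝ (Fin 3)) ∈ V := by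
    rw [hV, mem_parabolicCylinder]
    refine ⟨⟨?_, ?_⟩, ?_⟩
    · show (0 : ℝ) - r₂ ^ 2 < t
      rw [htdef, lt_div_iff₀ hL]
      have h1 : T - τ < r' ^ 2 := by linarith [hτI.1]
      -- `r'² ≤ L r₂²` since `ν r'² ≤ ρ² r₂² = ν L r₂²`
      have h2 : r' ^ 2 ≤ L * r₂ ^ 2 := by
        have h3 : ν * r' ^ 2 ≤ ν * (L * r₂ ^ 2) := by
          calc ν * r' ^ 2 ≤ (ρ * r₂) ^ 2 := hνr
            _ = ν * (L * r₂ ^ 2) := by rw [mul_pow, hρ2]; ring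
        exact le_of_mul_le_mul_left h3 hν
      linarith
    · show t < (0 : ℝ)
      rw [htdef]
      exact div_neg_of_neg_of_pos (by linarith [hτI.2]) hL
    · show dist y (0 : EuclideanSpace ℝ (Fin 3)) < r₂
      rw [dist_zero_right, hydef, norm_smul, norm_inv, Real.norm_of_nonneg hρ.le]
      have hxd : ‖x - x₀‖ < r' := by rw [← dist_eq_norm]; exact mem_ball.1 hxI
      rw [inv_mul_lt_iff₀ hρ]
      exact hxd.trans_le hr'ρ
  have hle := hpt _ hmem
  have hval : uncurry v (t, y) = c • u τ x := by
    simp only [uncurry, hv_apply]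
    rw [hτt, hxy]
  rw [hval, norm_smul, Real.norm_of_nonneg hc.le] at hle
  have : ‖u τ x‖ ≤ N / c := by
    rw [le_div_iff₀ hc, mul_comm]
    exact hle
  linarith

/-- **L49 AT THE FOCUS (maximal solutions).** For every maximal smooth solution `(u, p)` of the unforced
Navier–Stokes system on `ℝ³ × [0, T)` (`ν > 0`, `T > 0`), Leray–Hopf from `u 0`, there is a point `x₀` (the
singular point of L33′) such that: whenever a local Type-I bound `√(T − τ)‖u(τ, x)‖ ≤ C` holds on
`(t₁, T) × B(x₀, R)`, the vorticity direction admits no modulus of continuity over `{|ω| > d} ∩ B(x₀, R)` on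
`(t₁, T)`, for any `d > 0`. [cite: GigaMiura2011, Thm 2.10 with Def. 2.9 and Rmk 2.11 (§2.2)] -/
theorem typeI_direction_no_modulus {ν T : ℝ} (hν : 0 < ν) (hT : 0 < T)
    {u : ℝ → EuclideanSpace ℝ (Fin 3) → EuclideanSpace ℝ (Fin 3)} {p : ℝ → EuclideanSpace ℝ (Fin 3) → ℝ}
    (hmax : IsMaximalSmoothSolution ν 0 u p T) (hLH : IsLerayHopfOn T ν 0 (u 0) u) :
    ∃ x₀ : EuclideanSpace ℝ (Fin 3),
      (∀ r : ℝ, 0 < r → ∀ M : ℝ, ∃ t ∈ Ioo (T - r ^ 2) T, 0 < t ∧ ∃ x ∈ ball x₀ r, M < ‖u t x‖) ∧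
      ∀ (t₁ R C : ℝ), t₁ ∈ Ico 0 T → 0 < R → 0 < C →
        (∀ τ ∈ Ioo t₁ T, ∀ x ∈ ball x₀ R, Real.sqrt (T - τ) * ‖u τ x‖ ≤ C) →
        ∀ (d : ℝ) (η : ℝ → ℝ), 0 < d → MonotoneOn η (Ici 0) → ContinuousOn η (Ici 0) → η 0 = 0 →
          ¬ (∀ τ ∈ Ioo t₁ T, ∀ x ∈ ball x₀ R, ∀ x' ∈ ball x₀ R,
              d < ‖curl (u τ) x‖ → d < ‖curl (u τ) x'‖ →
                ‖vorticityDirection (curl (u τ)) x - vorticityDirection (curl (u τ)) x'‖ ≤ η ‖x - x'‖) := by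
  obtain ⟨x₀, hsing⟩ := exists_singularPoint hν hT hmax hLH
  exact ⟨x₀, hsing, fun t₁ R C ht₁ hR hC htypeI d η hd hηm hηc hη0 =>
    typeI_direction_no_modulus_at hν hT hmax.1 hLH hsing ht₁ hR hC htypeI hd hηm hηc hη0⟩

end Summit.NavierStokesRegularity.FluidComputer.TypeIDirectionFace

end
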